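import Summits.QuantumFields.BalabanUV.T4Continuum.Support.MinimalActionFromThm1
import Summits.QuantumFields.BalabanUV.T4Continuum.Support.AveragingDeficitKDatumTorus
import HarnessLib

/-!
# T⁴ programme, node NE3 (η-rate of the minimisers) — THE DICTIONARY, part 3: the local gauge shape IS row NE3-R2's
# `ExpGauge`, and the `ℓ²` gradient slot is its `gradFluxSq_period_le_scaling` BY NAME — B11 Theorem 1 for the torus
# instances ⇒ `UpperData` ⇒ `lim A_k(V)` exists, with NO gradient hypothesis left

NE3 formalisation swarm of the cell `pub-balaban`, crew item (s3), leaf seat `b2b-balaban-t4-ne3-formalise-leaf-06`; claim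
table `t4/formal/NE3/LEAVES.md` row S3.  Parts 1–2 (`MinimalActionDictionary`, `MinimalActionFromThm1`) left the local-gauge
shape `G` abstract with the two interface hypotheses `RadiiMono d G` and `hgrad`; here `G := AveragingDeficitKDatum.ExpGauge d`
(row NE3-R2: «on `box K y`, `V^u = exp a` with `‖a‖ ≤ α₀`, `‖∇a‖ ≤ α₁`, `‖Δa‖ ≤ α₂`» — B11 Thm 1 (8)+(10) TYPE), `RadiiMono` is
three `le_trans` (`radiiMono_expGauge`), and `hgrad` IS `AveragingDeficitKDatumTorus.gradFluxSq_period_le_scaling` (the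
discrete Caccioppoli route, row NE3-R2 gen 4) with constant `kReg d N_c c c c` at radii `c ≤ 1∕8`; the cube
monotonicity is `ExpGauge.mono`.  END:
**`upperData_of_thm1At_expGauge`** and **`exists_tendsto_minAct_of_thm1At_expGauge`** — CONDITIONAL only on
`∀ k, Thm1At C (torusVP d L N (ExpGauge d) (k+1))` (B11 Theorem 1 for the torus instances, a hypothesis asserted for nothing)
and the displayed smallness of `ε₁`.

HONEST FRAMING.  Finite-T⁴ ultraviolet bookkeeping about MINIMISERS; NOTHING of B11 is asserted (ABSOLUTE RULE of the cell);
no `sorry`, no axioms beyond Mathlib's; no conditional of the cell (`BetaPertH`, (B), (B^μ)) occurs; nothing bears on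
infinite volume, a mass gap, or the Clay problem; **NE3 is NOT proved** — headline «NE3-(A), existence of `lim A_k(V)`,
CONDITIONAL on ⟨`Thm1At` for the torus instances with `ExpGauge`⟩».  Divergences from print: part 1, D-s3-1 … D-s3-6.
PLACEMENT (human rule 2026-08-19): cell work under `Summits/QuantumFields/BalabanUV/`; imports part 2 and row NE3-R2's
`AveragingDeficitKDatumTorus` only; moves nothing.  Context: T. Bałaban, Commun. Math. Phys. **102** (1985) 277–309
[Balaban1985Variational], Thm 1 (8)–(10) p. 279.  Records: `t4/formal/NE3/LEAVES.md` row S3.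
-/

set_option autoImplicit false

open scoped BigOperators Matrix Matrix.Norms.L2Operator Topology
open NormedSpace Finset Filter

namespace Summit.QuantumFields.BalabanUV.T4Continuum.MinimalActionFromThm1KDatum

open Literature.MathematicalPhysics.QuantumFieldTheory.Balaban1983to89
open B7Prop1Explicit B7Prop2Explicit MatrixLog UnitaryModel
open T4AveragingDeficitWall hiding Site Plane Plaq Bond
open T4AveragingDeficitWallBoundary (IsPeriodicCfg periodBox)
open MinimalActionLevels MinimalActionSandwich MinimalActionRate MinimalActionLimit MinimalActionDictionary
  MinimalActionFromThm1
open AveragingDeficitKDatum (ExpGauge kReg)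
open AveragingDeficitKDatumTorus (gradFluxSq_period_le_scaling)
open B11Thm1 (Thm1At)

noncomputable section

variable {d : ℕ} {n : Type} [Fintype n] [DecidableEq n]


/-- Row NE3-R2's local exponential gauge shape is monotone in its three radii. [folklore] -/
theorem radiiMono_expGauge : RadiiMono d (ExpGauge (n := n) d) := by
  rintro U y K a₀ a₁ a₂ b₀ b₁ b₂ h0 h1 h2 ⟨u, a, hu, he, ha0, ha1, ha2⟩
  exact ⟨u, a, hu, he, fun z τ hz => (ha0 z τ hz).trans h0, fun z τ i hz => (ha1 z τ i hz).trans h1,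
    fun z τ hz => (ha2 z τ hz).trans h2⟩

/-- **B11 THEOREM 1 FOR THE TORUS INSTANCES (hypothesis) ⇒ `UpperData`, gradient slot discharged by row NE3-R2's K-datum.**
[cite: Balaban1985Variational, Thm 1 (8)–(10) p.279] -/
theorem upperData_of_thm1At_expGauge [Nonempty n] {L N : ℕ} (hL : 2 ≤ L) (C : B11Thm1.Consts) {ε₁ c : ℝ}
    (hε₁ : 0 < ε₁) (ha₁ : 7 / 3 * ε₁ ≤ C.a₁) {Kc : ℕ → ℕ} (hKc : ∀ j : ℕ, L ^ j - 1 + L ^ j + 2 ≤ Kc j)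
    (hMc : ∀ j : ℕ, cubeM L j (Kc j) ≤ C.Mfun (levelEps ε₁ L j))
    (hc : ∀ j : ℕ, C.B₃ * cubeM L j (Kc j) * levelEps ε₁ L j ≤ c) (hc0 : 0 ≤ c) (hc8 : c ≤ 1 / 8)
    (hsm : 512 * (d + 1) * (d + 4) * (L : ℝ) ^ 2 * (7 / 3 * (C.B₃ * ε₁)) ≤ 1)
    (hC₀ : lossConst d * (C.B₃ * ε₁) * 49 ≤ 9)
    (hThm : ∀ k : ℕ, Thm1At C (torusVP d L N (ExpGauge (n := n) d) (k + 1)))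
    {V : Site d → Fin d → (Matrix n n ℂ)ˣ} (hV : V ∈ sfClass d L N ε₁ 0) :
    UpperData d (thm1Class d L N C ε₁) L N (7 / 3 * (C.B₃ * ε₁)) (kReg d (Fintype.card n) c c c) V :=
  upperData_of_thm1At hL radiiMono_expGauge (fun _ _ _ _ _ _ _ hK h => h.mono hK)
    (fun j U hU hG => gradFluxSq_period_le_scaling hU (by omega) hc0 hc8 hc0 hc8 hG) C hε₁ ha₁ hKc hMc hc hsm hC₀
    hThm hV

/-- **HENCE `lim_k A_k(V)` EXISTS** for every datum with (7), from B11 Theorem 1 for the torus instances (hypothesis) and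
the kernel-checked sandwich + K-datum. [cite: Balaban1985Variational, Thm 1 (8)–(10) p.279] -/
theorem exists_tendsto_minAct_of_thm1At_expGauge [Nonempty n] {L N : ℕ} (hL : 2 ≤ L) (hN : 1 ≤ N)
    (C : B11Thm1.Consts) {ε₁ c : ℝ} (hε₁ : 0 < ε₁) (ha₁ : 7 / 3 * ε₁ ≤ C.a₁)
    {Kc : ℕ → ℕ} (hKc : ∀ j : ℕ, L ^ j - 1 + L ^ j + 2 ≤ Kc j)
    (hMc : ∀ j : ℕ, cubeM L j (Kc j) ≤ C.Mfun (levelEps ε₁ L j))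
    (hc : ∀ j : ℕ, C.B₃ * cubeM L j (Kc j) * levelEps ε₁ L j ≤ c) (hc0 : 0 ≤ c) (hc8 : c ≤ 1 / 8)
    (hsm : 512 * (d + 1) * (d + 4) * (L : ℝ) ^ 2 * (7 / 3 * (C.B₃ * ε₁)) ≤ 1)
    (hC₀ : lossConst d * (C.B₃ * ε₁) * 49 ≤ 9)
    (hThm : ∀ k : ℕ, Thm1At C (torusVP d L N (ExpGauge (n := n) d) (k + 1)))
    {V : Site d → Fin d → (Matrix n n ℂ)ˣ} (hV : V ∈ sfClass d L N ε₁ 0) :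
    ∃ A : ℝ, Tendsto (fun k => minAct d (thm1Class d L N C ε₁) L N k V) atTop (𝓝 A) := by
  have hg : 0 ≤ kReg d (Fintype.card n) c c c := by unfold kReg; positivity
  exact exists_tendsto_minAct hL hN (by have := C.B₃_pos.le; positivity) hsm hg
    (upperData_of_thm1At_expGauge hL C hε₁ ha₁ hKc hMc hc hc0 hc8 hsm hC₀ hThm hV)

end

end Summit.QuantumFields.BalabanUV.T4Continuum.MinimalActionFromThm1KDatum
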